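import Summits.Ventures.Crystal3D.TopCut.TammesCertComp
import Summits.Ventures.Crystal3D.TopCut.TammesCertDataD7b1
import Summits.Ventures.Crystal3D.TopCut.TammesCertDataD7b2
import Summits.Ventures.Crystal3D.TopCut.TammesCertDataD7b3
import Summits.Ventures.Crystal3D.TopCut.TammesCertDataD7b4
import Summits.Ventures.Crystal3D.TopCut.TammesCertDataD7b5
import Summits.Ventures.Crystal3D.TopCut.TammesCertDataD7b6
import Summits.Ventures.Crystal3D.TopCut.TammesCertDataD7b7
import HarnessLib

/-!
# Kernel checks (`decide +kernel`) of the `S²` certificate D7b: `T13(arccos(257/500))`, `d = N = 7` — part C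

Computational half only (soundness is `TammesCertDefs`, the theorem is `TammesTopCut257`): validation of the
claimed expansions — `F_int` in three block chunks (`FchunkOK3`), the Gram expansions `zᵀ(LLᵀ)z` by the
ROW-CHUNKED protocol `chunkOK` (15 rows per chunk: blocks `r` 8 chunks, `r_u`/`r_v`/`r_t` 6, `r_4` 4, `q`, `q_1` 1)
— and the four checks `checkSide3`, `checkBound3`, `checkI3`, `checkII3` of `TammesCertComp`, each by kernel
`decide` (standard axioms, no `native_decide`), spread over four files `TammesCertExpandD7b{A,B,C,D}`.
Statements are written directly in terms of the raw data of `TammesCertDataD7b1`–`7` (decoded by `ofFlat`).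
Tree form of the cell `pub-crystal3d`'s farm-checked single file `TammesKernelD7b.lean` (seat p2; split for the
gate by seat typer-bulk). This part: `certD7b_r_c4`, `certD7b_r_c5`, `certD7b_r_c6`, `certD7b_r_c7`, `certD7b_r_c8`, `certD7b_rv_c1`, `certD7b_rv_c2`, `certD7b_rv_c3`, `certD7b_rv_c4`.

## References
* C. Bachoc, F. Vallentin, J. Amer. Math. Soc. 21 (2008), Theorem 4.2, §5. [`BachocVallentin2007`]
-/

namespace Summit.Ventures.Crystal3D.TopCut

open Literature.Geometry.DiscreteGeometry Literature.Geometry.DiscreteGeometry.PolyCert Literature.Geometry.DiscreteGeometry.PolyCert.SPoly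

open Literature.Geometry.DiscreteGeometry Literature.Geometry.DiscreteGeometry.PolyCert Literature.Geometry.DiscreteGeometry.PolyCert.SPoly
open PolyCert.SPoly TammesD7bCert

set_option maxHeartbeats 0 in
set_option maxRecDepth 100000 in
/-- block `r`, rows 45 … 59. [folklore] -/
theorem certD7b_r_c4 : chunkOK (GramBlk.mk z_r L_r) 45 15 (ofFlat fD3_r_0 ++ ofFlat fD3_r_1 ++ ofFlat fD3_r_2 ++ ofFlat fD3_r_3 ++ ofFlat fD3_r_4) (ofFlat fD4_r_0 ++ ofFlat fD4_r_1 ++ ofFlat fD4_r_2 ++ ofFlat fD4_r_3 ++ ofFlat fD4_r_4 ++ ofFlat fD4_r_5) = true := by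
  decide +kernel

set_option maxHeartbeats 0 in
set_option maxRecDepth 100000 in
/-- block `r`, rows 60 … 74. [folklore] -/
theorem certD7b_r_c5 : chunkOK (GramBlk.mk z_r L_r) 60 15 (ofFlat fD4_r_0 ++ ofFlat fD4_r_1 ++ ofFlat fD4_r_2 ++ ofFlat fD4_r_3 ++ ofFlat fD4_r_4 ++ ofFlat fD4_r_5) (ofFlat fD5_r_0 ++ ofFlat fD5_r_1 ++ ofFlat fD5_r_2 ++ ofFlat fD5_r_3 ++ ofFlat fD5_r_4 ++ ofFlat fD5_r_5) = true := by
  decide +kernel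

set_option maxHeartbeats 0 in
set_option maxRecDepth 100000 in
/-- block `r`, rows 75 … 89. [folklore] -/
theorem certD7b_r_c6 : chunkOK (GramBlk.mk z_r L_r) 75 15 (ofFlat fD5_r_0 ++ ofFlat fD5_r_1 ++ ofFlat fD5_r_2 ++ ofFlat fD5_r_3 ++ ofFlat fD5_r_4 ++ ofFlat fD5_r_5) (ofFlat fD6_r_0 ++ ofFlat fD6_r_1 ++ ofFlat fD6_r_2 ++ ofFlat fD6_r_3 ++ ofFlat fD6_r_4 ++ ofFlat fD6_r_5 ++ ofFlat fD6_r_6) = true := by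
  decide +kernel

set_option maxHeartbeats 0 in
set_option maxRecDepth 100000 in
/-- block `r`, rows 90 … 104. [folklore] -/
theorem certD7b_r_c7 : chunkOK (GramBlk.mk z_r L_r) 90 15 (ofFlat fD6_r_0 ++ ofFlat fD6_r_1 ++ ofFlat fD6_r_2 ++ ofFlat fD6_r_3 ++ ofFlat fD6_r_4 ++ ofFlat fD6_r_5 ++ ofFlat fD6_r_6) (ofFlat fD7_r_0 ++ ofFlat fD7_r_1 ++ ofFlat fD7_r_2 ++ ofFlat fD7_r_3 ++ ofFlat fD7_r_4 ++ ofFlat fD7_r_5 ++ ofFlat fD7_r_6) = true := by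
  decide +kernel

set_option maxHeartbeats 0 in
set_option maxRecDepth 100000 in
/-- block `r`, rows 105 … 119. [folklore] -/
theorem certD7b_r_c8 : chunkOK (GramBlk.mk z_r L_r) 105 15 (ofFlat fD7_r_0 ++ ofFlat fD7_r_1 ++ ofFlat fD7_r_2 ++ ofFlat fD7_r_3 ++ ofFlat fD7_r_4 ++ ofFlat fD7_r_5 ++ ofFlat fD7_r_6) (ofFlat fR_r_0 ++ ofFlat fR_r_1 ++ ofFlat fR_r_2 ++ ofFlat fR_r_3 ++ ofFlat fR_r_4 ++ ofFlat fR_r_5 ++ ofFlat fR_r_6) = true := by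
  decide +kernel

set_option maxHeartbeats 0 in
set_option maxRecDepth 100000 in
/-- block `rv`, rows 0 … 14. [folklore] -/
theorem certD7b_rv_c1 : chunkOK (GramBlk.mk z_rv L_ru) 0 15 [] (permBAC (ofFlat fD1_ru_0 ++ ofFlat fD1_ru_1 ++ ofFlat fD1_ru_2)) = true := by
  decide +kernel

set_option maxHeartbeats 0 in
set_option maxRecDepth 100000 in
/-- block `rv`, rows 15 … 29. [folklore] -/
theorem certD7b_rv_c2 : chunkOK (GramBlk.mk z_rv L_ru) 15 15 (permBAC (ofFlat fD1_ru_0 ++ ofFlat fD1_ru_1 ++ ofFlat fD1_ru_2)) (permBAC (ofFlat fD2_ru_0 ++ ofFlat fD2_ru_1 ++ ofFlat fD2_ru_2)) = true := by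
  decide +kernel

set_option maxHeartbeats 0 in
set_option maxRecDepth 100000 in
/-- block `rv`, rows 30 … 44. [folklore] -/
theorem certD7b_rv_c3 : chunkOK (GramBlk.mk z_rv L_ru) 30 15 (permBAC (ofFlat fD2_ru_0 ++ ofFlat fD2_ru_1 ++ ofFlat fD2_ru_2)) (permBAC (ofFlat fD3_ru_0 ++ ofFlat fD3_ru_1 ++ ofFlat fD3_ru_2 ++ ofFlat fD3_ru_3)) = true := by
  decide +kernel

set_option maxHeartbeats 0 in
set_option maxRecDepth 100000 in
/-- block `rv`, rows 45 … 59. [folklore] -/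
theorem certD7b_rv_c4 : chunkOK (GramBlk.mk z_rv L_ru) 45 15 (permBAC (ofFlat fD3_ru_0 ++ ofFlat fD3_ru_1 ++ ofFlat fD3_ru_2 ++ ofFlat fD3_ru_3)) (permBAC (ofFlat fD4_ru_0 ++ ofFlat fD4_ru_1 ++ ofFlat fD4_ru_2 ++ ofFlat fD4_ru_3 ++ ofFlat fD4_ru_4)) = true := by
  decide +kernel

end Summit.Ventures.Crystal3D.TopCut
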